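import Summits.KontsevichZagierPeriods.KontsevichZagierPeriods.Theorems.SoloBlindCauchyStokesB
import Summits.KontsevichZagierPeriods.KontsevichZagierPeriods.Theorems.SoloBlindCauchyEdge
import HarnessLib

/-!
# Route A of the Cauchy argument: the compactified band chart `Φ_A(x,t) = (x, m(t))`

Sorry-free.  Second half of the Stokes/Cauchy theorem for the admissible representation
`[D, h_p]` of file `SoloBlindCauchyIntegrable`: integrating in `y` first.  As in Route B (file
`SoloBlindCauchyChartB`) the fibre coordinate is compactified by `y = m(t) = t/(1-t)`,
`t ∈ (0,1)`, so that the Newton–Leibniz move runs on the band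

  `bandA = {x < ½, x ≠ 0} × [0,1]`, fibres over the base `baseA = (-∞,0) ∪ (0,½)`,

with the fibrewise primitive `F_A(x,t) = P_p(x, m(t))` (`t < 1`), `F_A(x,1) = 0`, whose
`t`-derivative is `h_p(Φ_A) · m'(t)` (`∂P/∂y = h`) and whose values at the two ends are
`P_p(x, 0)` and `0` (decay `|P_p(x,y)| ≤ y^{2e} → 0`).  The line `x = 0` is removed from the
base so that `Φ_A` maps the half-open band into the chart domain `Eup` of file
`SoloBlindCauchySemialgebraic` (where `P_p, h_p` are semialgebraic); it has measure zero.

This file: the chart `Φ_A`, its Jacobian `m'(t) = (1-t)^{-2}`, the bands, the punctured domain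
`D_A = D ∖ {x = 0} = Φ_A((baseA) × (0,1))`, the pulled-back integrand `f_A` and primitive `F_A`
with their semialgebraicity, the integrability of `f_A`, and the null boundary of the band.
The Newton–Leibniz step and the conclusion are in `SoloBlindCauchyStokesA`.
-/

noncomputable section

open Set Complex MeasureTheory
open scoped ContDiff
open Literature.ModelTheory.ExponentialFields MvPolynomial
open Literature.NumberTheory.Transcendental
open Literature.NumberTheory.Transcendental.KZ

namespace Summit.KontsevichZagierPeriods.KontsevichZagierPeriods.Theorems

namespace SoloBlind

/-! ## The chart `Φ_A(x,t) = (x, m(t))` -/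

/-- The chart `Φ_A(x, t) = (x, t/(1-t))`. -/
def chartA (w : Fin 2 → ℝ) : Fin 2 → ℝ := ![w 0, moeb (w 1)]

/-- The derivative of `Φ_A` at `w` (for `w 1 ≠ 1`). -/
def chartADeriv (w : Fin 2 → ℝ) : (Fin 2 → ℝ) →L[ℝ] (Fin 2 → ℝ) :=
  ContinuousLinearMap.pi ![pr2 0, (1 / (1 - w 1) ^ 2) • pr2 1]

/-- `Φ_A` has derivative `chartADeriv w` at every `w` with `w 1 ≠ 1`. -/
theorem hasFDerivAt_chartA {w : Fin 2 → ℝ} (hw : w 1 ≠ 1) :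
    HasFDerivAt chartA (chartADeriv w) w := by
  have hπ0 : HasFDerivAt (fun q : Fin 2 → ℝ => q 0) (pr2 0) w := hasFDerivAt_apply 0 w
  have hπ1 : HasFDerivAt (fun q : Fin 2 → ℝ => q 1) (pr2 1) w := hasFDerivAt_apply 1 w
  rw [hasFDerivAt_pi']
  refine Fin.forall_fin_two.mpr ⟨?_, ?_⟩
  · have hfun : (fun q : Fin 2 → ℝ => chartA q 0) = fun q => q 0 := by
      funext q; simp [chartA]
    rw [hfun]
    refine hπ0.congr_fderiv (ContinuousLinearMap.ext fun v => ?_)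
    simp [chartADeriv]
  · have hfun : (fun q : Fin 2 → ℝ => chartA q 1) = fun q => moeb (q 1) := by
      funext q; simp [chartA]
    rw [hfun]
    refine ((hasDerivAt_moeb hw).comp_hasFDerivAt w hπ1).congr_fderiv
      (ContinuousLinearMap.ext fun v => ?_)
    simp [chartADeriv]

/-- `|det Φ_A'(w)| = 1/(1 - w 1)²`. -/
theorem abs_det_chartADeriv (w : Fin 2 → ℝ) : |(chartADeriv w).det| = 1 / (1 - w 1) ^ 2 := by
  have hM : LinearMap.toMatrix' ((chartADeriv w : (Fin 2 → ℝ) →L[ℝ] (Fin 2 → ℝ)) :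
      (Fin 2 → ℝ) →ₗ[ℝ] (Fin 2 → ℝ)) = !![1, 0; 0, 1 / (1 - w 1) ^ 2] := by
    ext i j
    rw [LinearMap.toMatrix'_apply, ContinuousLinearMap.coe_coe]
    fin_cases i <;> fin_cases j <;> simp [chartADeriv]
  rw [ContinuousLinearMap.det, ← LinearMap.det_toMatrix', hM, Matrix.det_fin_two_of,
    show (1 : ℝ) * (1 / (1 - w 1) ^ 2) - 0 * 0 = 1 / (1 - w 1) ^ 2 by ring]
  exact abs_of_nonneg (by positivity)

/-- `Φ_A` is injective on `{t < 1}`. -/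
theorem injOn_chartA : InjOn chartA {w | w 1 < 1} := by
  intro v hv w hw h
  have h0 := congr_fun h 0
  have h1 := congr_fun h 1
  simp only [chartA, Matrix.cons_val_zero, Matrix.cons_val_one, Matrix.cons_val_fin_one] at h0 h1
  have h1' : v 1 = w 1 := injOn_moeb (mem_Iio.mpr hv) (mem_Iio.mpr hw) h1
  ext i
  fin_cases i
  · exact h0
  · exact h1'

/-- `Φ_A` is a semialgebraic map on any semialgebraic set avoiding `{t = 1}`. -/
theorem isSemialgebraicMapOn_chartA {S : Set (Fin 2 → ℝ)} (hS : IsSemialgebraic ℚ S)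
    (hS1 : ∀ w ∈ S, w 1 ≠ 1) : IsSemialgebraicMapOn ℚ S chartA := by
  refine IsSemialgebraicMapOn.of_forall hS fun j => ?_
  fin_cases j
  · exact (isSemialgebraicFunOn_aeval hS (X 0)).congr fun w _ => by simp [chartA]
  · refine (isSemialgebraicFunOn_aeval_div_aeval hS (X 1) (1 - X 1) fun w hw => ?_).congr
      fun w _ => ?_
    · simpa [sub_eq_zero] using fun h => hS1 w hw h.symm
    · simp [chartA, moeb]

/-! ## The bands and the punctured domain -/

/-- `{w | w 0 ∈ baseA}` is semialgebraic in the plane. -/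
theorem isSemialgebraic_base2 : IsSemialgebraic ℚ {w : Fin 2 → ℝ | w 0 ∈ baseA} := by
  refine (congrArg (IsSemialgebraic (R := ℝ) ℚ) ?_).mpr
    ((isSemialgebraic_setOf_eval_pos (k := ℚ) (R := ℝ)
      (1 - 2 * X 0 : MvPolynomial (Fin 2) ℚ)).inter
      (isSemialgebraic_setOf_eval_ne_zero (k := ℚ) (R := ℝ) (X 0 : MvPolynomial (Fin 2) ℚ)))
  ext x
  simp only [baseA, mem_setOf_eq, mem_inter_iff, map_sub, map_mul, map_one,
    MvPolynomial.aeval_X]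
  constructor
  · rintro ⟨h1, h2⟩; exact ⟨by norm_num at h1 ⊢; linarith, h2⟩
  · rintro ⟨h1, h2⟩; exact ⟨by norm_num at h1 ⊢; linarith, h2⟩

/-- The open band `baseA × (0,1)`. -/
def openBandA : Set (Fin 2 → ℝ) := {w | w 0 ∈ baseA ∧ 0 < w 1 ∧ w 1 < 1}

/-- The compactified band `baseA × [0,1]`, the domain of the Newton–Leibniz move. -/
def bandA : Set (Fin 2 → ℝ) := {w | w 0 ∈ baseA ∧ 0 ≤ w 1 ∧ w 1 ≤ 1}

/-- The punctured domain `D_A = {x < ½, x ≠ 0, y > 0}`. -/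
def DomA : Set (Fin 2 → ℝ) := {z | z 0 ∈ baseA ∧ 0 < z 1}

/-- `openBandA ⊆ bandA`. -/
theorem openBandA_subset_bandA : openBandA ⊆ bandA :=
  fun _ hw => ⟨hw.1, hw.2.1.le, hw.2.2.le⟩

/-- `D_A ⊆ D`. -/
theorem DomA_subset_Dom : DomA ⊆ Dom := fun _ hz => ⟨hz.1.1, hz.2⟩

/-- `openBandA` is open. -/
theorem isOpen_openBandA : IsOpen openBandA := by
  have h : openBandA = ({w : Fin 2 → ℝ | w 0 < 1 / 2} ∩ {w | w 0 ≠ 0}) ∩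
      ({w | 0 < w 1} ∩ {w | w 1 < 1}) := by
    ext w
    simp only [openBandA, baseA, mem_setOf_eq, mem_inter_iff]
  rw [h]
  exact ((isOpen_lt (continuous_apply 0) continuous_const).inter
    (isOpen_ne_fun (continuous_apply 0) continuous_const)).inter
    ((isOpen_lt continuous_const (continuous_apply 1)).inter
      (isOpen_lt (continuous_apply 1) continuous_const))

/-- `openBandA` is semialgebraic. -/
theorem isSemialgebraic_openBandA : IsSemialgebraic ℚ openBandA := by
  refine (congrArg (IsSemialgebraic (R := ℝ) ℚ) ?_).mpr
    ((isSemialgebraic_base2.inter (isSemialgebraic_setOf_eval_pos (k := ℚ) (R := ℝ)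
      (X 1 : MvPolynomial (Fin 2) ℚ))).inter
      (isSemialgebraic_setOf_eval_pos (k := ℚ) (R := ℝ) (1 - X 1 : MvPolynomial (Fin 2) ℚ)))
  ext x
  simp only [openBandA, mem_setOf_eq, mem_inter_iff, map_sub, map_one, MvPolynomial.aeval_X,
    sub_pos, and_assoc]

/-- `bandA` is semialgebraic. -/
theorem isSemialgebraic_bandA : IsSemialgebraic ℚ bandA := by
  refine (congrArg (IsSemialgebraic (R := ℝ) ℚ) ?_).mpr
    ((isSemialgebraic_base2.inter (isSemialgebraic_setOf_eval_nonneg (k := ℚ) (R := ℝ)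
      (X 1 : MvPolynomial (Fin 2) ℚ))).inter
      (isSemialgebraic_setOf_eval_nonneg (k := ℚ) (R := ℝ) (1 - X 1 : MvPolynomial (Fin 2) ℚ)))
  ext x
  simp only [bandA, mem_setOf_eq, mem_inter_iff, map_sub, map_one, MvPolynomial.aeval_X,
    sub_nonneg, and_assoc]

/-- The half-open band `baseA × [0,1)` is semialgebraic. -/
theorem isSemialgebraic_bandA₁ :
    IsSemialgebraic ℚ {w : Fin 2 → ℝ | w 0 ∈ baseA ∧ 0 ≤ w 1 ∧ w 1 < 1} := by
  refine (congrArg (IsSemialgebraic (R := ℝ) ℚ) ?_).mpr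
    ((isSemialgebraic_base2.inter (isSemialgebraic_setOf_eval_nonneg (k := ℚ) (R := ℝ)
      (X 1 : MvPolynomial (Fin 2) ℚ))).inter
      (isSemialgebraic_setOf_eval_pos (k := ℚ) (R := ℝ) (1 - X 1 : MvPolynomial (Fin 2) ℚ)))
  ext x
  simp only [mem_setOf_eq, mem_inter_iff, map_sub, map_one, MvPolynomial.aeval_X, sub_pos,
    and_assoc]

/-- The edge `baseA × {1}` of the band is semialgebraic. -/
theorem isSemialgebraic_bandA₂ :
    IsSemialgebraic ℚ {w : Fin 2 → ℝ | w 0 ∈ baseA ∧ 1 ≤ w 1 ∧ w 1 ≤ 1} := by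
  refine (congrArg (IsSemialgebraic (R := ℝ) ℚ) ?_).mpr
    ((isSemialgebraic_base2.inter (isSemialgebraic_setOf_eval_nonneg (k := ℚ) (R := ℝ)
      (X 1 - 1 : MvPolynomial (Fin 2) ℚ))).inter
      (isSemialgebraic_setOf_eval_nonneg (k := ℚ) (R := ℝ) (1 - X 1 : MvPolynomial (Fin 2) ℚ)))
  ext x
  simp only [mem_setOf_eq, mem_inter_iff, map_sub, map_one, MvPolynomial.aeval_X, sub_nonneg,
    and_assoc]

/-- `D_A` is semialgebraic. -/
theorem isSemialgebraic_DomA : IsSemialgebraic ℚ DomA := by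
  refine (congrArg (IsSemialgebraic (R := ℝ) ℚ) ?_).mpr
    (isSemialgebraic_base2.inter (isSemialgebraic_setOf_eval_pos (k := ℚ) (R := ℝ)
      (X 1 : MvPolynomial (Fin 2) ℚ)))
  ext x
  simp only [DomA, mem_setOf_eq, mem_inter_iff, MvPolynomial.aeval_X]

/-- `bandA` is the union of the half-open band and its top edge. -/
theorem bandA_eq_union : bandA = {w : Fin 2 → ℝ | w 0 ∈ baseA ∧ 0 ≤ w 1 ∧ w 1 < 1} ∪
    {w : Fin 2 → ℝ | w 0 ∈ baseA ∧ 1 ≤ w 1 ∧ w 1 ≤ 1} := by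
  ext w
  simp only [bandA, mem_setOf_eq, mem_union]
  constructor
  · rintro ⟨h0, h1, h2⟩
    rcases lt_or_ge (w 1) 1 with h | h
    · exact Or.inl ⟨h0, h1, h⟩
    · exact Or.inr ⟨h0, h, h2⟩
  · rintro (⟨h0, h1, h2⟩ | ⟨h0, h1, h2⟩)
    · exact ⟨h0, h1, h2.le⟩
    · exact ⟨h0, by linarith, h2⟩

/-- `Φ_A` maps the half-open band into the chart domain `Eup`. -/
theorem chartA_mapsTo :
    MapsTo chartA {w : Fin 2 → ℝ | w 0 ∈ baseA ∧ 0 ≤ w 1 ∧ w 1 < 1} Eup := by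
  intro w hw
  obtain ⟨⟨hx, hx0⟩, h0, h1⟩ := hw
  refine ⟨?_, ?_, Or.inr ?_⟩
  · simpa [chartA] using moeb_nonneg h0 h1
  · simpa [chartA] using hx.le
  · simpa [chartA] using hx0

/-- `Φ_A(openBandA) = D_A`. -/
theorem image_chartA : chartA '' openBandA = DomA := by
  refine Subset.antisymm ?_ ?_
  · rintro _ ⟨w, hw, rfl⟩
    obtain ⟨hb, h0, h1⟩ := hw
    refine ⟨?_, ?_⟩
    · simpa [chartA] using hb
    · simpa [chartA] using moeb_pos h0 h1
  · intro z hz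
    obtain ⟨hb, hy⟩ := hz
    have hm : moeb (z 1 / (1 + z 1)) = z 1 := moeb_div_one_add hy.le
    refine ⟨![z 0, z 1 / (1 + z 1)], ⟨?_, ?_, ?_⟩, ?_⟩
    · simpa using hb
    · simpa using div_pos hy (by linarith)
    · simpa using (div_lt_one (by linarith)).mpr (by linarith)
    · ext i
      fin_cases i
      · simp [chartA]
      · simp only [chartA, Fin.mk_one, Matrix.cons_val_one, Matrix.cons_val_zero,
          Matrix.cons_val_fin_one]
        exact hm

/-! ## The pulled-back integrand and primitive -/

/-- The pulled-back integrand `f_A(x,t) = h_p(Φ_A(x,t)) m'(t)` (`t < 1`), `0` on the edge. -/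
def fA (p : ℕ) (w : Fin 2 → ℝ) : ℝ :=
  if w 1 < 1 then Hz p (chartA w) / (1 - w 1) ^ 2 else 0

/-- The fibrewise primitive `F_A(x,t) = P_p(Φ_A(x,t))` (`t < 1`), `0` on the edge. -/
def FA (p : ℕ) (w : Fin 2 → ℝ) : ℝ := if w 1 < 1 then Pz p (chartA w) else 0

/-- `f_A` is semialgebraic on the band. -/
theorem sa_fA (p : ℕ) : IsSemialgebraicFunOn ℚ bandA (fA p) := by
  have h1 : IsSemialgebraicFunOn ℚ {w : Fin 2 → ℝ | w 0 ∈ baseA ∧ 0 ≤ w 1 ∧ w 1 < 1}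
      (fun w => Hz p (chartA w) / (1 - w 1) ^ 2) := by
    have hsa := (sa_Hz p).comp_isSemialgebraicMapOn_holds
      (isSemialgebraicMapOn_chartA isSemialgebraic_bandA₁ fun w hw => ne_of_lt hw.2.2)
      chartA_mapsTo
    have hq := isSemialgebraicFunOn_aeval_div_aeval isSemialgebraic_bandA₁
      (1 : MvPolynomial (Fin 2) ℚ) ((1 - X 1) ^ 2) fun w hw => by
        simpa [sub_eq_zero] using fun h => (ne_of_lt hw.2.2) h.symm
    exact (hsa.fun_mul hq).congr fun w _ => by simp [Function.comp, div_eq_mul_inv]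
  rw [bandA_eq_union]
  refine h1.union (isSemialgebraicFunOn_const_of_isAlgebraic isSemialgebraic_bandA₂
    isAlgebraic_zero) (fun w hw => ?_) (fun w hw => ?_)
  · exact if_pos hw.2.2
  · exact if_neg (not_lt.mpr hw.2.1)

/-- `F_A` is semialgebraic on the band. -/
theorem sa_FA (p : ℕ) : IsSemialgebraicFunOn ℚ bandA (FA p) := by
  have h1 : IsSemialgebraicFunOn ℚ {w : Fin 2 → ℝ | w 0 ∈ baseA ∧ 0 ≤ w 1 ∧ w 1 < 1}
      (fun w => Pz p (chartA w)) :=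
    (sa_PQ p).1.comp_isSemialgebraicMapOn_holds
      (isSemialgebraicMapOn_chartA isSemialgebraic_bandA₁ fun w hw => ne_of_lt hw.2.2)
      chartA_mapsTo
  rw [bandA_eq_union]
  refine h1.union (isSemialgebraicFunOn_const_of_isAlgebraic isSemialgebraic_bandA₂
    isAlgebraic_zero) (fun w hw => ?_) (fun w hw => ?_)
  · exact if_pos hw.2.2
  · exact if_neg (not_lt.mpr hw.2.1)

/-! ## The punctured representation and integrability of `f_A` -/

/-- `D ∖ D_A ⊆ {x = 0}` is a null set. -/
theorem volume_Dom_diff : volume (Dom \ DomA) = 0 := by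
  refine measure_mono_null (fun z hz => ?_) (by
    rw [MeasureTheory.volume_pi]
    exact Measure.pi_hyperplane (fun _ => (volume : Measure ℝ)) 0 (0 : ℝ))
  obtain ⟨⟨hx, hy⟩, h2⟩ := hz
  by_contra h0
  exact h2 ⟨⟨hx, h0⟩, hy⟩

/-- The punctured representation `[D_A, h_p]`, the restriction of `[D, h_p]`. -/
def cauchyRepA (p : ℕ) (hp : p = 1 ∨ p = 2) : IntegralRep 2 :=
  (cauchyRep p hp).restrict DomA isSemialgebraic_DomA DomA_subset_Dom

/-- `[D, h_p] - [D_A, h_p]` is a relation (the removed line is null). -/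
theorem cauchyRep_sub_cauchyRepA (p : ℕ) (hp : p = 1 ∨ p = 2) :
    of (cauchyRep p hp) - of (cauchyRepA p hp) ∈ relations :=
  (cauchyRep p hp).of_sub_of_restrict_mem_relations isSemialgebraic_DomA DomA_subset_Dom
    volume_Dom_diff

/-- `f_A` is integrable on the open band: it is the pull-back of the integrable `h_p` on `D_A`. -/
theorem integrableOn_fA (p : ℕ) (hp : p = 1 ∨ p = 2) : IntegrableOn (fA p) openBandA := by
  have h := (integrableOn_iff_of_chart (S := openBandA) (Φ := chartA) (Φ' := chartADeriv)
    (J := fun w => 1 / (1 - w 1) ^ 2) (f := fA p) (g := Hz p)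
    isOpen_openBandA.measurableSet (fun w hw => hasFDerivAt_chartA (ne_of_lt hw.2.2))
    (injOn_chartA.mono fun w hw => hw.2.2) (fun w _ => abs_det_chartADeriv w)
    (fun w hw => by simp [fA, hw.2.2, div_eq_mul_inv])).mp
  rw [image_chartA] at h
  exact h (cauchyRepA p hp).integrableOn

/-- The boundary of the band is null: `bandA ∖ openBandA ⊆ {t = 0} ∪ {t = 1}`. -/
theorem volume_bandA_diff : volume (bandA \ openBandA) = 0 := by
  have hpl : ∀ a : ℝ, volume {w : Fin 2 → ℝ | w 1 = a} = 0 := fun a => by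
    rw [MeasureTheory.volume_pi]
    exact Measure.pi_hyperplane (fun _ => (volume : Measure ℝ)) 1 a
  refine measure_mono_null (fun w hw => ?_) (measure_union_null (hpl 0) (hpl 1))
  obtain ⟨⟨h0, h1, h2⟩, hn⟩ := hw
  simp only [openBandA, mem_setOf_eq, not_and, not_lt] at hn
  rcases h1.lt_or_eq with h1' | h1'
  · exact Or.inr (le_antisymm h2 (hn h0 h1'))
  · exact Or.inl h1'.symm

end SoloBlind

end Summit.KontsevichZagierPeriods.KontsevichZagierPeriods.Theorems
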